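import Summits.HodgeConjecture.CorCM.Census.SexticDecicWeilDefect
import HarnessLib

/-!
# `E × T × B` over a sextic and a decic CM field sharing `k`: the PARTS of a balanced configuration — conjugate pairs, Weil FOURFOLD
# parts (`T × E`), Weil SIXFOLD parts (`B × E`) and EIGHTFOLD parts (`T × B̄`)

COR-CM (cell `pub-hodgecm2`), seat b30 gen 27 (2026-08-23); count-neutral own lane SEXTIC-DECIC, sequel of
`Census/SexticDecicWeil{,Defect}.lean`; the degree-`(6,10)` twin of gen 26ʼs `Census/SexticOcticWeilParts.lean`.  Six bookkeeping
definitions (the part predicates) and theorems of the finite model; no named fact, no geometry, no `sorry`, no `decide`.  Splittings and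
balance follow in `Census/SexticDecicWeilPartsBalanced.lean`, extraction and induction in `Census/SexticDecicWeilExtraction.lean`.

For a configuration `(T, v : α → PtSD)` (the coordinates of a product of copies of `E, T, B` with their labels):
* `IsPairPartSD v G` — two points with labels `{y, ȳ}` (a divisor weight);
* `IsThreePartSD v b G` / `IsFivePartSD v b G` — one point over each threefold label `(1, a, b)`, `a < 3` / each fivefold label `(2, a, b)`,
  `a < 5` (the halves `⋀³ H¹(T)_b`, `⋀⁵ H¹(B)_b`; NOT Hodge classes);
* `IsFourPartSD v b G` — a curve point over `τ_b` plus a three part of sign `b`: a lift of the Weil weight of the FOURFOLD `T × E`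
  (`k`-signature `(1,2) + (1,0) = (2,2)`);
* `IsSixPartSD v b G` — a curve point over `τ_b` plus a five part of sign `b`: a lift of the Weil weight of the SIXFOLD `B × E`
  (`k`-signature `(2,3) + (1,0) = (3,3)`);
* `IsEightPartSD v b G` — a three part of sign `b` and a five part of sign `¬b`: a lift of the Weil weight of the EIGHTFOLD `T × B̄`
  (`k`-signature `(1,2) + (3,2) = (4,4)`).
This file: the definitions, the count functions of the elementary parts, their selection from the counts, the evaluated counts.
[cite: MoonenZarhin1995Duke, Thm. 2.4] [cite: Gordon1999HodgeAVSurvey, 5.13 (ii), 9.2.2] [cite: Milne2020HodgeClassesAV, 1.2 (a)]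

## References
* [MoonenZarhin1995Duke] B. Moonen, Yu. Zarhin, Duke Math. J. 77 (1995), Thm. 2.4.  [Gordon1999HodgeAVSurvey] B. B. Gordon, CRM
  Monogr. 10 (1999), 5.13 (ii), 9.2.2.  [Milne2020HodgeClassesAV] J. S. Milne, arXiv:2010.08857, 1.2 (a).
-/

namespace Summit.HodgeConjecture.CorCM.Census.SexticDecicWeil

open Finset

variable {α : Type*} {v : α → PtSD}

/-! ### The parts -/

/-- **A pair part**: two points over a conjugate pair of labels `{y, cjSD y}` (a divisor weight, possibly spread over two copies).
[cite: Gordon1999HodgeAVSurvey, 9.2.2] -/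
def IsPairPartSD (v : α → PtSD) (G : Finset α) : Prop :=
  ∃ y : PtSD, G.card = 2 ∧ Set.InjOn v ↑G ∧ G.image v = {y, cjSD y}

/-- **A three part of sign `b`**: one point over each threefold label `(1, a, b)` — the weight of `⋀³ H¹(T)_b` (NOT a Hodge class).
[cite: MoonenZarhin1995Duke, Thm. 2.4] -/
def IsThreePartSD (v : α → PtSD) (b : Bool) (G : Finset α) : Prop :=
  G.card = 3 ∧ ∀ a : Fin 3, (G.filter fun x => v x = Sum.inr (Sum.inl (a, b))).card = 1

/-- **A five part of sign `b`**: one point over each fivefold label `(2, a, b)` — the weight of `⋀⁵ H¹(B)_b` (NOT a Hodge class).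
[cite: MoonenZarhin1995Duke, Thm. 2.4] -/
def IsFivePartSD (v : α → PtSD) (b : Bool) (G : Finset α) : Prop :=
  G.card = 5 ∧ ∀ a : Fin 5, (G.filter fun x => v x = Sum.inr (Sum.inr (a, b))).card = 1

/-- **A Weil FOURFOLD part of sign `b`**: one curve point over `τ_b` and a three part of sign `b` — a lift of the Weil weight of `T × E`.
[cite: MoonenZarhin1995Duke, Thm. 2.4] [cite: Gordon1999HodgeAVSurvey, 5.13 (ii)] -/
def IsFourPartSD (v : α → PtSD) (b : Bool) (G : Finset α) : Prop :=
  G.card = 4 ∧ (G.filter fun x => v x = Sum.inl b).card = 1 ∧ ∀ a : Fin 3, (G.filter fun x => v x = Sum.inr (Sum.inl (a, b))).card = 1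

/-- **A Weil SIXFOLD part of sign `b`**: one curve point over `τ_b` and a five part of sign `b` — a lift of the Weil weight
`[τ_b] + Σ_a [(a, b)]` of `B × E`. [cite: MoonenZarhin1995Duke, Thm. 2.4] [cite: Gordon1999HodgeAVSurvey, 5.13 (ii)] -/
def IsSixPartSD (v : α → PtSD) (b : Bool) (G : Finset α) : Prop :=
  G.card = 6 ∧ (G.filter fun x => v x = Sum.inl b).card = 1 ∧ ∀ a : Fin 5, (G.filter fun x => v x = Sum.inr (Sum.inr (a, b))).card = 1

/-- **A Weil EIGHTFOLD part of sign `b`**: a three part of sign `b` and a five part of sign `¬b` — a lift of the Weil weight of the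
eightfold `T × B̄`. [cite: MoonenZarhin1995Duke, Thm. 2.4] [cite: Gordon1999HodgeAVSurvey, 5.13 (ii)] -/
def IsEightPartSD (v : α → PtSD) (b : Bool) (G : Finset α) : Prop :=
  G.card = 8 ∧ (∀ a : Fin 3, (G.filter fun x => v x = Sum.inr (Sum.inl (a, b))).card = 1) ∧
    ∀ a : Fin 5, (G.filter fun x => v x = Sum.inr (Sum.inr (a, !b))).card = 1

/-! ### Count functions of the elementary parts -/

/-- The count function of a pair part: `1` on `y` and `cjSD y`, `0` elsewhere. [folklore] -/
theorem IsPairPartSD.count_eq [DecidableEq α] {G : Finset α} (hG : IsPairPartSD v G) : ∃ y : PtSD, ∀ z : PtSD,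
    (G.filter fun x => v x = z).card = if z = y ∨ z = cjSD y then 1 else 0 := by
  obtain ⟨y, hcard, hinj, himg⟩ := hG
  refine ⟨y, fun z => ?_⟩
  have hfib : ∀ z, (G.filter fun x => v x = z).card = if z ∈ G.image v then 1 else 0 := by
    intro z
    split_ifs with hz
    · obtain ⟨x, hx, rfl⟩ := Finset.mem_image.1 hz
      rw [Finset.card_eq_one]
      refine ⟨x, Finset.eq_singleton_iff_unique_mem.2 ⟨Finset.mem_filter.2 ⟨hx, rfl⟩, fun x' hx' => ?_⟩⟩
      exact hinj (Finset.mem_of_mem_filter _ hx') hx (Finset.mem_filter.1 hx').2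
    · rw [Finset.card_eq_zero, Finset.filter_eq_empty_iff]
      exact fun x hx hxz => hz (hxz ▸ Finset.mem_image_of_mem v hx)
  rw [hfib z, himg]
  simp only [Finset.mem_insert, Finset.mem_singleton]

/-- The fibres over pairwise distinct labels `f a` (`f` injective) and one further fibre fit into `G`. [folklore] -/
private theorem sum_fibres_add_le {n : ℕ} (G : Finset α) {f : Fin n → PtSD} (hf : Function.Injective f) {z : PtSD}
    (hz : ∀ a, z ≠ f a) :
    ∑ a : Fin n, (G.filter fun x => v x = f a).card + (G.filter fun x => v x = z).card ≤ G.card := by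
  classical
  have hpd : ∀ a ∈ (univ : Finset (Fin n)), ∀ a' ∈ (univ : Finset (Fin n)), a ≠ a' →
      Disjoint (G.filter fun x => v x = f a) (G.filter fun x => v x = f a') :=
    fun a _ a' _ haa => Finset.disjoint_filter.2 fun x _ h1 h2 => haa (hf (h1.symm.trans h2))
  have hdisj : Disjoint ((univ : Finset (Fin n)).biUnion fun a => G.filter fun x => v x = f a) (G.filter fun x => v x = z) :=
    (Finset.disjoint_biUnion_left _ _ _).2 fun a _ => Finset.disjoint_filter.2 fun x _ h1 h2 => hz a (h2.symm.trans h1)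
  rw [← Finset.card_biUnion hpd, ← Finset.card_union_of_disjoint hdisj]
  exact Finset.card_le_card (Finset.union_subset (Finset.biUnion_subset.2 fun a _ => Finset.filter_subset _ _)
    (Finset.filter_subset _ _))

/-- The threefold labels `(1, a, b)`, `a < 3`, are pairwise distinct. [folklore] -/
theorem inr_inl_injective (b : Bool) : Function.Injective fun a : Fin 3 => (Sum.inr (Sum.inl (a, b)) : PtSD) :=
  fun a a' h => by simpa using h

/-- The fivefold labels `(2, a, b)`, `a < 5`, are pairwise distinct. [folklore] -/
theorem inr_inr_injective (b : Bool) : Function.Injective fun a : Fin 5 => (Sum.inr (Sum.inr (a, b)) : PtSD) :=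
  fun a a' h => by simpa using h

/-- The count function of a three part of sign `b`: `1` on the three `(1, a, b)`, `0` elsewhere. [folklore] -/
theorem IsThreePartSD.count_eq {b : Bool} {G : Finset α} (hG : IsThreePartSD v b G) (z : PtSD) :
    (G.filter fun x => v x = z).card = if ∃ a : Fin 3, z = Sum.inr (Sum.inl (a, b)) then 1 else 0 := by
  classical
  obtain ⟨hcard, hB⟩ := hG
  split_ifs with hz
  · obtain ⟨a, rfl⟩ := hz
    exact hB a
  · push Not at hz
    have hle := sum_fibres_add_le (v := v) G (inr_inl_injective b) hz
    simp only [hB, Finset.sum_const, Finset.card_univ, Fintype.card_fin, smul_eq_mul, mul_one, hcard] at hle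
    omega

/-- The count function of a five part of sign `b`: `1` on the five `(2, a, b)`, `0` elsewhere. [folklore] -/
theorem IsFivePartSD.count_eq {b : Bool} {G : Finset α} (hG : IsFivePartSD v b G) (z : PtSD) :
    (G.filter fun x => v x = z).card = if ∃ a : Fin 5, z = Sum.inr (Sum.inr (a, b)) then 1 else 0 := by
  classical
  obtain ⟨hcard, hB⟩ := hG
  split_ifs with hz
  · obtain ⟨a, rfl⟩ := hz
    exact hB a
  · push Not at hz
    have hle := sum_fibres_add_le (v := v) G (inr_inr_injective b) hz
    simp only [hB, Finset.sum_const, Finset.card_univ, Fintype.card_fin, smul_eq_mul, mul_one, hcard] at hle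
    omega

/-! ### Elementary properties of three and five parts -/

/-- Every point of a three part lies over a label `(1, a, b)`. [folklore] -/
theorem IsThreePartSD.exists_eq {b : Bool} {G : Finset α} (hG : IsThreePartSD v b G) {x : α} (hx : x ∈ G) :
    ∃ a : Fin 3, v x = Sum.inr (Sum.inl (a, b)) := by
  classical
  have hpos : 0 < (G.filter fun x' => v x' = v x).card := Finset.card_pos.2 ⟨x, Finset.mem_filter.2 ⟨hx, rfl⟩⟩
  rw [hG.count_eq] at hpos
  by_contra h
  rw [if_neg h] at hpos
  exact lt_irrefl 0 hpos

/-- Every point of a five part lies over a label `(2, a, b)`. [folklore] -/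
theorem IsFivePartSD.exists_eq {b : Bool} {G : Finset α} (hG : IsFivePartSD v b G) {x : α} (hx : x ∈ G) :
    ∃ a : Fin 5, v x = Sum.inr (Sum.inr (a, b)) := by
  classical
  have hpos : 0 < (G.filter fun x' => v x' = v x).card := Finset.card_pos.2 ⟨x, Finset.mem_filter.2 ⟨hx, rfl⟩⟩
  rw [hG.count_eq] at hpos
  by_contra h
  rw [if_neg h] at hpos
  exact lt_irrefl 0 hpos

/-- The model map is injective on a three part. [folklore] -/
theorem IsThreePartSD.injOn {b : Bool} {G : Finset α} (hG : IsThreePartSD v b G) : Set.InjOn v ↑G := by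
  classical
  intro x hx x' hx' h
  have hle : (G.filter fun y => v y = v x).card ≤ 1 := by
    rw [hG.count_eq]; split_ifs <;> omega
  exact Finset.card_le_one.1 hle x (Finset.mem_filter.2 ⟨hx, rfl⟩) x' (Finset.mem_filter.2 ⟨hx', h.symm⟩)

/-- The model map is injective on a five part. [folklore] -/
theorem IsFivePartSD.injOn {b : Bool} {G : Finset α} (hG : IsFivePartSD v b G) : Set.InjOn v ↑G := by
  classical
  intro x hx x' hx' h
  have hle : (G.filter fun y => v y = v x).card ≤ 1 := by
    rw [hG.count_eq]; split_ifs <;> omega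
  exact Finset.card_le_one.1 hle x (Finset.mem_filter.2 ⟨hx, rfl⟩) x' (Finset.mem_filter.2 ⟨hx', h.symm⟩)

/-- A pair part is non-empty. [folklore] -/
theorem IsPairPartSD.nonempty {G : Finset α} (hG : IsPairPartSD v G) : G.Nonempty := by
  obtain ⟨_, hcard, -⟩ := hG
  rw [← Finset.card_pos, hcard]; norm_num

/-- A three part inside `T` from the counts: one point over each `(1, a, b)`. [folklore] -/
theorem exists_threePartSD_of_counts [DecidableEq α] {T : Finset α} (b : Bool)
    (hB : ∀ a : Fin 3, 0 < (T.filter fun x => v x = Sum.inr (Sum.inl (a, b))).card) : ∃ G ⊆ T, IsThreePartSD v b G := by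
  have hpick : ∀ a : Fin 3, ∃ x ∈ T, v x = Sum.inr (Sum.inl (a, b)) := fun a => by
    obtain ⟨x, hx⟩ := Finset.card_pos.1 (hB a)
    exact ⟨x, (Finset.mem_filter.1 hx).1, (Finset.mem_filter.1 hx).2⟩
  choose pick hpickT hpickv using hpick
  have hpinj : Function.Injective pick := fun a a' h => by
    have e := hpickv a
    rw [h, hpickv a'] at e
    have : a' = a := by simpa using e
    exact this.symm
  refine ⟨univ.image pick, fun x hx => by obtain ⟨a, -, rfl⟩ := Finset.mem_image.1 hx; exact hpickT a, ?_, fun a => ?_⟩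
  · rw [Finset.card_image_of_injective _ hpinj, Finset.card_univ, Fintype.card_fin]
  · rw [Finset.card_eq_one]
    refine ⟨pick a, ?_⟩
    ext x
    simp only [Finset.mem_filter, Finset.mem_image, Finset.mem_univ, true_and, Finset.mem_singleton]
    constructor
    · rintro ⟨⟨a', rfl⟩, hvx⟩
      rw [hpickv a'] at hvx
      have : a' = a := by simpa using hvx
      rw [this]
    · rintro rfl
      exact ⟨⟨a, rfl⟩, hpickv a⟩

/-- A five part inside `T` from the counts: one point over each `(2, a, b)`. [folklore] -/
theorem exists_fivePartSD_of_counts [DecidableEq α] {T : Finset α} (b : Bool)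
    (hB : ∀ a : Fin 5, 0 < (T.filter fun x => v x = Sum.inr (Sum.inr (a, b))).card) : ∃ G ⊆ T, IsFivePartSD v b G := by
  have hpick : ∀ a : Fin 5, ∃ x ∈ T, v x = Sum.inr (Sum.inr (a, b)) := fun a => by
    obtain ⟨x, hx⟩ := Finset.card_pos.1 (hB a)
    exact ⟨x, (Finset.mem_filter.1 hx).1, (Finset.mem_filter.1 hx).2⟩
  choose pick hpickT hpickv using hpick
  have hpinj : Function.Injective pick := fun a a' h => by
    have e := hpickv a
    rw [h, hpickv a'] at e
    have : a' = a := by simpa using e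
    exact this.symm
  refine ⟨univ.image pick, fun x hx => by obtain ⟨a, -, rfl⟩ := Finset.mem_image.1 hx; exact hpickT a, ?_, fun a => ?_⟩
  · rw [Finset.card_image_of_injective _ hpinj, Finset.card_univ, Fintype.card_fin]
  · rw [Finset.card_eq_one]
    refine ⟨pick a, ?_⟩
    ext x
    simp only [Finset.mem_filter, Finset.mem_image, Finset.mem_univ, true_and, Finset.mem_singleton]
    constructor
    · rintro ⟨⟨a', rfl⟩, hvx⟩
      rw [hpickv a'] at hvx
      have : a' = a := by simpa using hvx
      rw [this]
    · rintro rfl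
      exact ⟨⟨a, rfl⟩, hpickv a⟩

/-- A pair part inside `T` from the counts: one point over `y` and one over `cjSD y`. [folklore] -/
theorem exists_pairPartSD_of_counts [DecidableEq α] {T : Finset α} (y : PtSD)
    (hy : 0 < (T.filter fun x => v x = y).card) (hcy : 0 < (T.filter fun x => v x = cjSD y).card) :
    ∃ G ⊆ T, IsPairPartSD v G := by
  obtain ⟨x, hx₀⟩ := Finset.card_pos.1 hy
  obtain ⟨hxT, hx⟩ := Finset.mem_filter.1 hx₀
  obtain ⟨x', hx₀'⟩ := Finset.card_pos.1 hcy
  obtain ⟨hx'T, hx'⟩ := Finset.mem_filter.1 hx₀'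
  have hne : x ≠ x' := by
    intro h
    apply cjSD_ne y
    rw [← hx', ← h, hx]
  refine ⟨{x, x'}, ?_, y, Finset.card_pair hne, ?_, ?_⟩
  · intro z hz
    rcases Finset.mem_insert.1 hz with rfl | hz
    · exact hxT
    · rw [Finset.mem_singleton.1 hz]; exact hx'T
  · intro z hz z' hz' hzz'
    simp only [Finset.coe_insert, Finset.coe_singleton, Set.mem_insert_iff, Set.mem_singleton_iff] at hz hz'
    rcases hz with rfl | rfl <;> rcases hz' with rfl | rfl
    · rfl
    · exfalso; rw [hx, hx'] at hzz'; exact cjSD_ne y hzz'.symm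
    · exfalso; rw [hx, hx'] at hzz'; exact cjSD_ne y hzz'
    · rfl
  · rw [Finset.image_insert, Finset.image_singleton, hx, hx']

/-! ### The count functions in evaluated form -/

/-- A three part: no point over the curve labels. [folklore] -/
theorem IsThreePartSD.card_filter_inl {b : Bool} {G : Finset α} (hG : IsThreePartSD v b G) (b' : Bool) :
    (G.filter fun x => v x = Sum.inl b').card = 0 := by
  classical
  rw [hG.count_eq, if_neg]
  rintro ⟨a, ha⟩
  exact Sum.inl_ne_inr ha

/-- A three part: one point over `(1, a, b)`, none over the other threefold labels. [folklore] -/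
theorem IsThreePartSD.card_filter_inr_inl {b : Bool} {G : Finset α} (hG : IsThreePartSD v b G) (a : Fin 3) (b' : Bool) :
    (G.filter fun x => v x = Sum.inr (Sum.inl (a, b'))).card = if b' = b then 1 else 0 := by
  classical
  rw [hG.count_eq]
  by_cases h : b' = b
  · subst h; rw [if_pos ⟨a, rfl⟩, if_pos rfl]
  · rw [if_neg h, if_neg]
    rintro ⟨a', ha'⟩
    simp only [Sum.inr.injEq, Sum.inl.injEq, Prod.mk.injEq] at ha'
    exact h ha'.2

/-- A three part: no point over the fivefold labels. [folklore] -/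
theorem IsThreePartSD.card_filter_inr_inr {b : Bool} {G : Finset α} (hG : IsThreePartSD v b G) (a : Fin 5) (b' : Bool) :
    (G.filter fun x => v x = Sum.inr (Sum.inr (a, b'))).card = 0 := by
  classical
  rw [hG.count_eq, if_neg]
  rintro ⟨a', ha'⟩
  simp only [Sum.inr.injEq] at ha'
  exact Sum.inr_ne_inl ha'

/-- A five part: no point over the curve labels. [folklore] -/
theorem IsFivePartSD.card_filter_inl {b : Bool} {G : Finset α} (hG : IsFivePartSD v b G) (b' : Bool) :
    (G.filter fun x => v x = Sum.inl b').card = 0 := by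
  classical
  rw [hG.count_eq, if_neg]
  rintro ⟨a, ha⟩
  exact Sum.inl_ne_inr ha

/-- A five part: no point over the threefold labels. [folklore] -/
theorem IsFivePartSD.card_filter_inr_inl {b : Bool} {G : Finset α} (hG : IsFivePartSD v b G) (a : Fin 3) (b' : Bool) :
    (G.filter fun x => v x = Sum.inr (Sum.inl (a, b'))).card = 0 := by
  classical
  rw [hG.count_eq, if_neg]
  rintro ⟨a', ha'⟩
  simp only [Sum.inr.injEq] at ha'
  exact Sum.inl_ne_inr ha'

/-- A five part: one point over `(2, a, b)`, none over the other fivefold labels. [folklore] -/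
theorem IsFivePartSD.card_filter_inr_inr {b : Bool} {G : Finset α} (hG : IsFivePartSD v b G) (a : Fin 5) (b' : Bool) :
    (G.filter fun x => v x = Sum.inr (Sum.inr (a, b'))).card = if b' = b then 1 else 0 := by
  classical
  rw [hG.count_eq]
  by_cases h : b' = b
  · subst h; rw [if_pos ⟨a, rfl⟩, if_pos rfl]
  · rw [if_neg h, if_neg]
    rintro ⟨a', ha'⟩
    simp only [Sum.inr.injEq, Prod.mk.injEq] at ha'
    exact h ha'.2

end Summit.HodgeConjecture.CorCM.Census.SexticDecicWeil
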